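import Summits.QuantumFields.YangMills.Theorems.BalabanUVNodesK0V19Stub2Prime
import Summits.QuantumFields.YangMills.Theorems.BalabanUVNodesK2NamedJetsRunRemAt
import Summits.QuantumFields.YangMills.Theorems.BalabanUVNodesD4KernelDecayOfWindowed
import Literature.MathematicalPhysics.QuantumFieldTheory.Balaban1983to89.Node00.U3KernelLetters

/-!
# K0⁷ — SUPPLIER JUNCTIONS INTO THE RUN-WISE FACE 3ᴿ OF STUB 3ᴬ′ AT A1's WITNESS `θ₁₅ᶜᶜᴹ(j)`, (j, c)-GENERIC:
# (a) node O's RUN PAIR (one-loop drift + run-wise constant remainder) ⟹ 3ᴿ; (b) the (5.10) KERNEL-DECAY CURRENCY of the (D4)∕K3 side (W1-19's limiting kernels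
# `U3OfKernels.kernelA`), with ONE constant over runs and levels ⟹ 3ᴿ — and its WINDOW edition ⟹ V19's box socket `K0V19Defs.AbsBetaBoxAtThm1WitnessCCMGenAt F`;
# (c) the finite-volume passage (windowed (5.10) with one constant + the (1.21) letter of record) into (b), by name

Cell `pub-ymgap`, width seat `pub-ymgap-k0-s3-w1` (g0; director-ym R399 (3a) ∕ №207 «k0-s3-w1∕w2 → (j,c)-generic sub-faces of `stub_absBetaBoxAtThm1WitnessCCMGen13` by
CLAIM»; HUMAN RULING D-0154; this seat's CLAIM-2 after YIELD-1 to k0-s3-w2's first CLAIM on the run-wise ROAD).  `--kind proof --supports stmt-QuantumFields-20541 --as helper`,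
COUNT-NEUTRAL.  NEW leaf; nothing modified; theorems only — 0 `def`, 0 `sorry`, no new named fact.  Over: `Thm/…K0V19Stub2Prime` (p595104: stub 2′ LANDED; `Thm/…K0V19Defs` p594829: V19's socket texts by name), DEF-1's run
letter `Thm/…K2NamedJetsRunRemAt` (p596574: the TREE predicate `RunConstRemainder`), n22-w3's `Thm/…D4KernelDecayOfWindowed` (`YMDAG.N22.AtKernels.decay510_kernelA_of_windowed`),
W1-19 `Node00/U3OfKernels` (`kernelA`, `Window`), W1 `Node00/U3KernelLetters` (`PolLimitsExistOfRecord₁₃`), b12 `B12Sec2to5` (`Decay510`, `secondMoment_abs_le_of_decay510`,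
`betaPrime510`), `Beta/DriftRemainder` (`abs_beta0_sub_le_of_drift`).  [15] = [Balaban1985Variational]; [6] = [Balaban1985RegularSpaces]; [I] = [Balaban1987RG1];
[II] = [Balaban1989LargeFieldII]; [III] = [Balaban1988Convergent]; [RG2] = [Balaban1988RG2Cluster].

WHY.  V19's registered stub 3ᴬ′ (`K0V19Defs.AbsBetaBoxAtThm1WitnessCCMGenAt F`, BOX-wide) has a RUN-WISE face 3ᴿ — the same (j, c)-generic prefix with the box conjuncts replaced by
`RunConstRemainder (betaOfRecord₁₃ F 2 (theta13OfThm1CCM F 2 j ε₀ ε₂₉ B₃ B₃' a₀ a₁)) (fun _ => 0) β′ γ₀` (|β_{k+1}(g₀,…,g_k)| ≤ β′ at every prefix `k ≤ n` of every solution of (0.20)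
up to `n` staying in `]0, γ₀]`; [I] Thm 3 p. 264 read along solutions; node O P3 row W-R3A) — typed and taken to K0⁷ BY NAME by the twin seat k0-s3-w2 (`Thm/…K0Stub3RunwiseFace`).
THIS FILE supplies 3ᴿ (and, in the same currency, 3ᴬ′) FROM THE TWO SHAPES IN WHICH NODE O's CONTENT IS CARRIED ELSEWHERE IN THE TREE, so that either road, once inhabited
at A1's witness, lands K0⁷ through the run face by name:
(a) the K2⁷ RUN PAIR shape (DEF-1's `RunRemAt`: a one-loop drift `OneLoopDrift s A b` of named numbers `b` + the run-wise constant remainder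
    `RunConstRemainder β (c • b) r γ₀`) — generic bookkeeping `|β| ≤ |c|·(|s| + 2A) + r` along runs (§1), read at the witness (§4);
(b) the (D4)∕K3 KERNEL shape: (5.10)-decay `B12Sec2to5.Decay510 (kernelA … g k 0 1) C δ₁` of W1-19's LIMITING (1.21) kernels of the merged term family of record — the object
    `U3OfKernels.KernelDecayOfRecord₁₃` quantifies with a constant PER coupling sequence; K0 needs ONE constant over the in-window runs and all levels (displayed so, inline),
    whence `|β_{k+1}| ≤ β′₅₁₀(C, δ₁) = C·Σ_{x∈ℤ⁴}|x|₁²e^{−δ₁|x|₁}` by b12's `secondMoment_abs_le_of_decay510` ([I] (5.42) + (5.10) ⇒ «uniformly bounded», p. 264) (§2 run form,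
    §3 window∕box form);
(c) the finite-volume passage into (b): windowed (5.10) bounds holding eventually in the volume index `K` with ONE constant, plus the (1.21) letter of record
    `U3KernelLetters.PolLimitsExistOfRecord₁₃` ([I] p. 264 «This limit exists by the localized representation (1.7)»), give the limit-level hypothesis of (b)
    (`decay510_kernelA_of_windowed` BY NAME) (§3).
Idea-6's crux sketch (`Cruxes/Record13SepCoPHInhabited/HessCovHeredityK0Sketch.lean` §3–§4) proves the box road from FINITE-VOLUME `∀ K` decay on box histories; this file is its
TREE-importable twin in W1's window∕kernel currency plus the RUN editions — no line of it is copied; the hypotheses here are W1-19∕W1 letters with the constant made uniform.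

CONTENTS (kernel-checked; CONDITIONAL — every drift ∕ remainder ∕ decay ∕ limit hypothesis is DISPLAYED, inhabited nowhere).
§1 generic (`β : HBeta`): `runConstRemainder_zero_of_drift_runConstRemainder` (+ `…_smul` for the `c • b` anchor of `RunRemAt`).
§2 θ-generic run form: `betaOfRecord₁₃_prefix_eq_secondMoment_kernelA` (on an in-window prefix the β of record IS (1.22) of W1-19's run-A kernel — unfolding),
   ★ `runConstRemainder_zero_of_kernelDecayRunsUniform`.
§3 θ-generic window∕box form: `betaOfRecord₁₃_eq_secondMoment_kernelA_extd`, ★ `absBetaBox_of_kernelDecayWindowUniform`, `kernelDecayRunsUniform_of_windowUniform` (window ⟹ runs),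
   `kernelDecayWindowUniform_of_windowedUniform_of_polLimitsExist` ((c)).
§4 at A1's witness `θ₁₅ᶜᶜᴹ(j)` (`.γ = ½`), (j, c)-generic prefixes VERBATIM: ★★ `run3R_of_driftRunPairAt`, ★★ `run3R_of_kernelDecayRunsUniformAt`, ★★ `absBetaBoxGenAt_of_kernelDecayWindowUniformAt`
   (concludes `K0V19Defs.AbsBetaBoxAtThm1WitnessCCMGenAt F` BY NAME), `run3R_of_kernelDecayWindowUniformAt`.
§5 ★★★ `record13SepCoPHInhabited_of_stub1_of_kernelDecayWindowUniformAt_byName` — K0⁷ BY NAME from V19 stub 1's text `K0V19Defs.Prop8StepCoPAt`, the LANDED stub 2′ (p595104, inside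
   `K0V19Stub2Prime.record13SepCoPHInhabited_of_stub1_stub3A'_byName`) and the window-uniform (5.10) decay at A1's witness (§4 ⟹ 3ᴬ′ by name).  The RUN-road compositions
   (§4's 3ᴿ producers ∘ k0-s3-w2's `…K0Stub3RunwiseFace` consumer) are by that file's names once it lands — not restated here.

HONEST FRAMING (binding).  Elementary real bookkeeping ((0.20) prefixes lie in the boxes; |Σ Π x₀x₁| under (5.10); triangle inequality under a drift) and by-name composition;
NOTHING of Bałaban's analysis is asserted or proved: the drift, the run remainder, the uniform (5.10) decay of the record's kernels and the existence of the (1.21) limits are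
HYPOTHESES (node O's wall ∕ print's [I] §5 content at the record); 3ᴿ ∕ 3ᴬ′ NOT proved; K0⁷ stmt-QuantumFields-20541 OPEN (V19 87879403b3a26109: stub 2′ landed p595104, stubs 1 ∕ 3ᴬ′
open) and NOT claimed; no count claim (typed 28∕28 · discharged 5∕27 unmoved); no summit statement is proved by this seat; route R4 closes the CONDITIONAL finite-𝕋⁴ rung
`BalabanLadder.UV` only — NOTHING about the continuum limit, ℝ⁴, OS axioms, a mass gap or the Clay problem is proved or claimed.  No `sorry`, `def`, `instance`, `notation`, `axiom`.
-/

noncomputable section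

open scoped Matrix.Norms.L2Operator
open Filter Topology

namespace Summit.QuantumFields.YangMills.Theorems.K0Stub3RunwiseSuppliers

open Literature.MathematicalPhysics.QuantumFieldTheory.Balaban1983to89
open Literature.MathematicalPhysics.QuantumFieldTheory.Balaban1983to89.Node00
open Literature.MathematicalPhysics.QuantumFieldTheory.Balaban1983to89.T4Continuum
open Literature.MathematicalPhysics.QuantumFieldTheory.Balaban1983to89.FlowStep
open Literature.MathematicalPhysics.QuantumFieldTheory.Balaban1983to89.T4OutputRate (Window)
open Literature.MathematicalPhysics.QuantumFieldTheory.Balaban1983to89.T4FlagMemory (extd)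
open Literature.MathematicalPhysics.QuantumFieldTheory.Balaban1983to89.T4BetaReadOut (extd_mem_window)
open Literature.MathematicalPhysics.QuantumFieldTheory.Balaban1983to89.B12Sec2to5 (l1 Decay510 betaPrime510 secondMoment_abs_le_of_decay510)
open Literature.MathematicalPhysics.QuantumFieldTheory.Balaban1983to89.Beta.Drift (OneLoopDrift)
open Literature.MathematicalPhysics.QuantumFieldTheory.Balaban1983to89.Beta.DriftRemainder (abs_beta0_sub_le_of_drift)
open Literature.MathematicalPhysics.QuantumFieldTheory.Balaban1983to89.Node00.U3OfKernels (histPrefix kernelA kernelA_eq kernelA_extd kernelA_congr)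
open Literature.MathematicalPhysics.QuantumFieldTheory.Balaban1983to89.Node00.U3KernelLetters (PolLimitsExistOfRecord₁₃)
open Summit.QuantumFields.YangMills.Theorems.K0V19Defs (Prop8StepCoPAt AbsBetaBoxAtThm1WitnessCCMGenAt)
open Summit.QuantumFields.YangMills.Theorems.K0V19Stub2Prime (record13SepCoPHInhabited_of_stub1_stub3A'_byName)
open Summit.QuantumFields.YangMills.Theorems.BalabanUVNodesK2NamedJetsRunRemAt (RunConstRemainder)
open YMDAG.N22.AtKernels (decay510_kernelA_of_windowed)

/-! ## §1  Generic: node O's RUN PAIR (drift + run-wise constant remainder) ⟹ the run-wise ABS bound (the 3ᴿ letter shape `RunConstRemainder β 0 β′ γ₀`) -/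

section DriftPair

variable {β : HBeta} {b : ℕ → ℝ}

/-- **DRIFT + RUN REMAINDER ⟹ RUN-WISE ABS BOUND**: a one-loop drift `|Σ_{j<k} b_j − s·k| ≤ A` (so `|b_k − s| ≤ 2A`, `Beta.DriftRemainder.abs_beta0_sub_le_of_drift`) and a run-wise
constant remainder `|β_{k+1}(g₀,…,g_k) − c·b_k| ≤ r` along the in-window solutions of (0.20) give `|β_{k+1}(g₀,…,g_k)| ≤ |c|·(|s| + 2A) + r` along the same runs — the run twin of
the box bookkeeping behind N26 ∕ an4's `betaBox_of_drift_…` (triangle inequality; no sign of anything is read). [cite: Balaban1987RG1, Thm 3 p.264, (2.12)–(2.14) p.268 (bookkeeping)] -/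
theorem runConstRemainder_zero_of_drift_runConstRemainder {s A c r γ₀ : ℝ} (hdrift : OneLoopDrift s A b)
    (hrem : RunConstRemainder β (fun k => c * b k) r γ₀) : RunConstRemainder β (fun _ => 0) (|c| * (|s| + 2 * A) + r) γ₀ := by
  intro n gs hrg hI k hk
  have h1 : |β k (prefixOf gs k) - c * b k| ≤ r := hrem n gs hrg hI k hk
  have h2 : |b k - s| ≤ 2 * A := abs_beta0_sub_le_of_drift hdrift k
  have h3 : |b k| ≤ |s| + 2 * A := by
    have := abs_sub_abs_le_abs_sub (b k) s
    linarith
  have h4 : |c * b k| ≤ |c| * (|s| + 2 * A) := by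
    rw [abs_mul]
    exact mul_le_mul_of_nonneg_left h3 (abs_nonneg c)
  rw [sub_zero]
  calc |β k (prefixOf gs k)| = |(β k (prefixOf gs k) - c * b k) + c * b k| := by ring_nf
    _ ≤ |β k (prefixOf gs k) - c * b k| + |c * b k| := abs_add_le _ _
    _ ≤ r + |c| * (|s| + 2 * A) := add_le_add h1 h4
    _ = |c| * (|s| + 2 * A) + r := by ring

/-- The same with the anchor spelled `c • b` (DEF-1's `RunRemAt` conjunct `RunConstRemainder β (c • b) s γ₀`). [cite: Balaban1987RG1, Thm 3 p.264 (bookkeeping)] -/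
theorem runConstRemainder_zero_of_drift_runConstRemainder_smul {s A c r γ₀ : ℝ} (hdrift : OneLoopDrift s A b)
    (hrem : RunConstRemainder β (c • b) r γ₀) : RunConstRemainder β (fun _ => 0) (|c| * (|s| + 2 * A) + r) γ₀ :=
  runConstRemainder_zero_of_drift_runConstRemainder hdrift fun n gs hrg hI k hk => by
    simpa only [Pi.smul_apply, smul_eq_mul] using hrem n gs hrg hI k hk

end DriftPair

/-! ## §2  θ-generic, RUN form: ONE-constant (5.10)-decay of W1-19's limiting kernels along the in-window runs ⟹ `RunConstRemainder β₁₃(θ) 0 β′₅₁₀ γ₀` -/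

section Record

variable (F : T4Family) (N : ℕ) [NeZero N] (θ : Stage13Params F N)

/-- **ON AN IN-WINDOW RUN PREFIX THE β OF RECORD IS (1.22) OF W1-19's RUN-A KERNEL** (unfolding: the prefix `(g₀,…,g_k)`, `k ≤ n`, of a sequence in `]0, γ₀]` up to `n`, `γ₀ ≤ θ.γ`,
lies in the design box, where `betaOfRecord₁₃ θ` IS the merged β (`betaOfMerged_of_mem`) = `Σ_z Π_{k+1}(g₀,…,g_k; z) z₀ z₁` of the limiting kernel `kernelA … gs k = polLimit …`).
[cite: Balaban1987RG1, (1.20)–(1.22) p.264 (bookkeeping)] -/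
theorem betaOfRecord₁₃_prefix_eq_secondMoment_kernelA {γ₀ : ℝ} (hγ : γ₀ ≤ θ.γ) {n k : ℕ} {gs : ℕ → ℝ} (hI : Step.InInterval γ₀ n gs) (hk : k ≤ n) :
    betaOfRecord₁₃ F N θ k (prefixOf gs k) =
      (letI := θ.instVβ₁; letI := θ.instVβ₂; letI := θ.instιβ
       B12Beta.secondMoment (kernelA F (mergedTermFamilyMatT F N (TβOfRecord₁₃ F N) (chiβOfRecord₁₃ F N θ) θ.εbg) θ.ρ8 θ.bV gs k) 0 1) := by
  letI := θ.instVβ₁; letI := θ.instVβ₂; letI := θ.instιβ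
  have hbox : prefixOf gs k ∈ Box θ.γ k :=
    mem_box.mpr fun i => ⟨(hI i ((Nat.lt_succ_iff.mp i.isLt).trans hk)).1, (hI i ((Nat.lt_succ_iff.mp i.isLt).trans hk)).2.trans hγ⟩
  rw [betaOfRecord₁₃_eq_betaOfRecord₈Tχ]
  exact betaOfMerged_of_mem _ _ _ hbox

/-- **★ RUN FORM: ONE-CONSTANT (5.10)-DECAY OF THE LIMITING KERNELS ALONG THE IN-WINDOW RUNS ⟹ THE RUN LETTER** (`γ₀ ≤ θ.γ`, `0 < δ₁`): if along every solution `gs` of (0.20) for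
`β₁₃(θ)` up to `n` staying in `]0, γ₀]` and every level `k ≤ n` the limiting kernel `Π_{k+1}(g₀,…,g_k; ·)` (W1-19's `kernelA`, directions `(0, 1)`) obeys `|Π(z)| ≤ C e^{−δ₁|z|₁}` with ONE
`(C, δ₁)`, then `|β_{k+1}(g₀,…,g_k)| ≤ β′₅₁₀ = C·Σ_{x∈ℤ⁴}|x|₁²e^{−δ₁|x|₁}` there (b12 `secondMoment_abs_le_of_decay510`: (5.42) + (5.10) ⇒ p. 264 «uniformly bounded»), i.e.
`RunConstRemainder β₁₃(θ) 0 β′₅₁₀ γ₀`.  CONDITIONAL on the displayed decay; the per-sequence letter `U3OfKernels.KernelDecayOfRecord₁₃` does NOT suffice (its constant depends on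
the run). [cite: Balaban1987RG1, (5.10) p.293, (5.42) p.297, (1.22) p.264, Thm 3 p.264] -/
theorem runConstRemainder_zero_of_kernelDecayRunsUniform {γ₀ C δ₁ : ℝ} (hδ : 0 < δ₁) (hγ : γ₀ ≤ θ.γ)
    (hdec : letI := θ.instVβ₁; letI := θ.instVβ₂; letI := θ.instιβ
      ∀ (n : ℕ) (gs : ℕ → ℝ), RGEqH n (betaOfRecord₁₃ F N θ) gs → Step.InInterval γ₀ n gs → ∀ k, k ≤ n →
        Decay510 (kernelA F (mergedTermFamilyMatT F N (TβOfRecord₁₃ F N) (chiβOfRecord₁₃ F N θ) θ.εbg) θ.ρ8 θ.bV gs k 0 1) C δ₁) :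
    RunConstRemainder (betaOfRecord₁₃ F N θ) (fun _ => 0) (betaPrime510 4 C δ₁) γ₀ := by
  letI := θ.instVβ₁; letI := θ.instVβ₂; letI := θ.instιβ
  intro n gs hrg hI k hk
  rw [sub_zero, betaOfRecord₁₃_prefix_eq_secondMoment_kernelA F N θ hγ hI hk]
  exact (secondMoment_abs_le_of_decay510 hδ (hdec n gs hrg hI k hk)).2

/-! ## §3  θ-generic, WINDOW∕BOX form: ONE-constant decay over W1-19's window `]0, γ₀]^ℕ` ⟹ the BOX `−β′₅₁₀ ≤ β₁₃(θ) ≤ β′₅₁₀` on `]0, γ₀]^{k+1}`; window ⟹ runs; the finite-volume passage -/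

/-- **ON A BOX HISTORY THE β OF RECORD IS (1.22) OF THE RUN-A KERNEL OF THE PADDED SEQUENCE** (`v ∈ ]0, γ₀]^{k+1}`, `γ₀ ≤ θ.γ`; W1-19's `secondMoment_kernelA_extd` +
`betaOfMerged_of_mem`). [cite: Balaban1987RG1, (1.20)–(1.22) p.264 (bookkeeping)] -/
theorem betaOfRecord₁₃_eq_secondMoment_kernelA_extd {γ₀ : ℝ} (hγ : γ₀ ≤ θ.γ) {k : ℕ} {v : Fin (k + 1) → ℝ} (hv : v ∈ Box γ₀ k) :
    betaOfRecord₁₃ F N θ k v =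
      (letI := θ.instVβ₁; letI := θ.instVβ₂; letI := θ.instιβ
       B12Beta.secondMoment (kernelA F (mergedTermFamilyMatT F N (TβOfRecord₁₃ F N) (chiβOfRecord₁₃ F N θ) θ.εbg) θ.ρ8 θ.bV (extd v) k) 0 1) := by
  letI := θ.instVβ₁; letI := θ.instVβ₂; letI := θ.instιβ
  have hbox : v ∈ Box θ.γ k := box_mono hγ k hv
  rw [betaOfRecord₁₃_eq_betaOfRecord₈Tχ, U3OfKernels.secondMoment_kernelA_extd]
  exact betaOfMerged_of_mem _ _ _ hbox

/-- **★ WINDOW FORM: ONE-CONSTANT (5.10)-DECAY OF THE LIMITING KERNELS OVER THE WINDOW `]0, γ₀]^ℕ` ⟹ THE SIGN-FREE β-BOX ON `]0, γ₀]`** (`γ₀ ≤ θ.γ`, `0 < δ₁`):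
`BetaLowerH (−β′₅₁₀) γ₀ β₁₃(θ) ∧ BetaUpperH β′₅₁₀ γ₀ β₁₃(θ)` — W1-19's `KernelDecayOfRecord₁₃`-shape with the constant UNIFORM over the window (displayed so, inline), read on box
histories through their padded sequences (`extd v ∈ Window γ₀`).  The TREE-importable twin, in limit-kernel currency, of idea-6's `absBox_of_finVolDecay_polLimit`.  CONDITIONAL.
[cite: Balaban1987RG1, (5.10) p.293, (5.42) p.297, (1.22) p.264, §1 p.264 («uniformly bounded»)] -/
theorem absBetaBox_of_kernelDecayWindowUniform {γ₀ C δ₁ : ℝ} (hδ : 0 < δ₁) (hγ : γ₀ ≤ θ.γ)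
    (hdec : letI := θ.instVβ₁; letI := θ.instVβ₂; letI := θ.instιβ
      ∀ g ∈ Window γ₀, ∀ k : ℕ, Decay510 (kernelA F (mergedTermFamilyMatT F N (TβOfRecord₁₃ F N) (chiβOfRecord₁₃ F N θ) θ.εbg) θ.ρ8 θ.bV g k 0 1) C δ₁) :
    BetaLowerH (-betaPrime510 4 C δ₁) γ₀ (betaOfRecord₁₃ F N θ) ∧ BetaUpperH (betaPrime510 4 C δ₁) γ₀ (betaOfRecord₁₃ F N θ) := by
  letI := θ.instVβ₁; letI := θ.instVβ₂; letI := θ.instιβ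
  have key : ∀ (k : ℕ) (v : Fin (k + 1) → ℝ), v ∈ Box γ₀ k → |betaOfRecord₁₃ F N θ k v| ≤ betaPrime510 4 C δ₁ := by
    intro k v hv
    rw [betaOfRecord₁₃_eq_secondMoment_kernelA_extd F N θ hγ hv]
    exact (secondMoment_abs_le_of_decay510 hδ (hdec (extd v) (extd_mem_window hv) k)).2
  exact ⟨fun k v hv => (abs_le.mp (key k v hv)).1, fun k v hv => (abs_le.mp (key k v hv)).2⟩

/-- **WINDOW ⟹ RUNS** for the one-constant decay hypothesis: the level-`k` kernel of an in-window run up to `n ≥ k` is the level-`k` kernel of the padded prefix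
`extd (g₀,…,g_n) ∈ Window γ₀` (prefix dependence, `kernelA_congr`).  So §2's run hypothesis is WEAKER than §3's window hypothesis. [cite: Balaban1987RG1, §5 p.298 (bookkeeping)] -/
theorem kernelDecayRunsUniform_of_windowUniform {γ₀ C δ₁ : ℝ}
    (hdec : letI := θ.instVβ₁; letI := θ.instVβ₂; letI := θ.instιβ
      ∀ g ∈ Window γ₀, ∀ k : ℕ, Decay510 (kernelA F (mergedTermFamilyMatT F N (TβOfRecord₁₃ F N) (chiβOfRecord₁₃ F N θ) θ.εbg) θ.ρ8 θ.bV g k 0 1) C δ₁) :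
    letI := θ.instVβ₁; letI := θ.instVβ₂; letI := θ.instιβ
    ∀ (n : ℕ) (gs : ℕ → ℝ), RGEqH n (betaOfRecord₁₃ F N θ) gs → Step.InInterval γ₀ n gs → ∀ k, k ≤ n →
      Decay510 (kernelA F (mergedTermFamilyMatT F N (TβOfRecord₁₃ F N) (chiβOfRecord₁₃ F N θ) θ.εbg) θ.ρ8 θ.bV gs k 0 1) C δ₁ := by
  letI := θ.instVβ₁; letI := θ.instVβ₂; letI := θ.instιβ
  intro n gs _ hI k hk
  have hbox : prefixOf gs n ∈ Box γ₀ n := mem_box.mpr fun i => hI i (Nat.lt_succ_iff.mp i.isLt)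
  have hcongr : kernelA F (mergedTermFamilyMatT F N (TβOfRecord₁₃ F N) (chiβOfRecord₁₃ F N θ) θ.εbg) θ.ρ8 θ.bV gs k =
      kernelA F (mergedTermFamilyMatT F N (TβOfRecord₁₃ F N) (chiβOfRecord₁₃ F N θ) θ.εbg) θ.ρ8 θ.bV (extd (prefixOf gs n)) k :=
    kernelA_congr F _ θ.ρ8 θ.bV fun i hi => (T4FlagMemoryTwoRun.extd_prefixOf (by omega)).symm
  rw [hcongr]
  exact hdec _ (extd_mem_window hbox) k

/-- **(c) THE FINITE-VOLUME PASSAGE INTO §3's HYPOTHESIS, BY NAME**: windowed (5.10) bounds `|Π^{(K)}_{k+1,01}(g; z)| ≤ C e^{−δ₁|z|₁}` holding EVENTUALLY in the volume index `K`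
with ONE constant over `g ∈ ]0, γ₀]^ℕ` and all `k` (W1's `WindowedDecay` shape with the `∃ C₀` moved outside), plus W1's (1.21) letter of record `PolLimitsExistOfRecord₁₃ F N θ`
([I] p. 264 «This limit exists by the localized representation (1.7)»), give the one-constant decay of the LIMITING kernels over the window (n22-w3's `decay510_kernelA_of_windowed`:
`le_of_tendsto` on `|·|`).  Estimate-free; both inputs displayed. [cite: Balaban1987RG1, (5.10) p.293, (1.21) p.264] -/
theorem kernelDecayWindowUniform_of_windowedUniform_of_polLimitsExist {γ₀ C δ₁ : ℝ} (hγ : γ₀ ≤ θ.γ) (hlim : PolLimitsExistOfRecord₁₃ F N θ)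
    (hK : letI := θ.instVβ₁; letI := θ.instVβ₂; letI := θ.instιβ
      ∀ g ∈ Window γ₀, ∀ (k : ℕ) (z : Fin 4 → ℤ), ∀ᶠ K in atTop,
        |polWindow F K (k + 1) (mergedTermFamilyMatT F N (TβOfRecord₁₃ F N) (chiβOfRecord₁₃ F N θ) θ.εbg k (histPrefix g k) K) θ.ρ8 θ.bV 0 1 z| ≤ C * Real.exp (-δ₁ * l1 z)) :
    letI := θ.instVβ₁; letI := θ.instVβ₂; letI := θ.instιβ
    ∀ g ∈ Window γ₀, ∀ k : ℕ, Decay510 (kernelA F (mergedTermFamilyMatT F N (TβOfRecord₁₃ F N) (chiβOfRecord₁₃ F N θ) θ.εbg) θ.ρ8 θ.bV g k 0 1) C δ₁ := by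
  letI := θ.instVβ₁; letI := θ.instVβ₂; letI := θ.instιβ
  intro g hg k
  have hg' : g ∈ Window θ.γ := fun i => ⟨(hg i).1, (hg i).2.trans hγ⟩
  exact decay510_kernelA_of_windowed F _ θ.ρ8 θ.bV (hlim g hg' k) (hK g hg k)

end Record

/-! ## §4  At A1's collared witness `θ₁₅ᶜᶜᴹ(j)` (`.γ = ½`), (j, c)-generic: the 3ᴿ text from either supplier shape; V19's box socket 3ᴬ′ BY NAME from the window shape -/

section Witness

/-- **★★ (a) NODE O's RUN PAIR AT A1's WITNESS ⟹ 3ᴿ(F)**: if for every cube letter `(j, c)` with `c ≤ L^j` and every guarded tuple carrying (8) and the (9)-token at `(L^j, c)` SOME thresholds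
`ε₀, ε₂₉ > 0`, window `γ₀ > 0`, named numbers `b`, slope `s`, drift width `A`, scale `c′` and remainder `r` give a one-loop drift `OneLoopDrift s A b` and the run-wise constant remainder
`RunConstRemainder β₁₃(θ₁₅ᶜᶜᴹ(j)) (c′·b) r γ₀`, then 3ᴿ(F) holds with `β′ := |c′|·(|s| + 2A) + r` (§1).  The RUN twin of PART 1 §4's `absBetaBoxAt_of_jetsFreePairAt`.  CONDITIONAL on the pair
(node O's; [I] Thm 2 p. 259 unproved in print, [II] p. 355); nothing asserted. [cite: Balaban1987RG1, Thm 2 p.259, Thm 3 p.264, (2.12)–(2.14) p.268; Balaban1985Variational, Thm 1 p.279, Prop. 8 p.304; Balaban1988Convergent, Thm 1 p.262] -/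
theorem run3R_of_driftRunPairAt (F : T4Family)
    (h : ∀ (j c : ℕ) (B₃ B₃' a₀ a₁ : ℝ), c ≤ F.L ^ j → 2 * (F.L : ℝ) ^ 2 ≤ B₃ → 0 < B₃' → 0 < a₀ → 0 < a₁ →
      VariationalThm1RegSepCoP7M F 2 B₃ a₀ a₁ →
      Gauge9RegSepTopStepR F 2 (fun ν K Ω => suppDomOfRecord F ν K Ω) (F.L ^ j) c B₃ B₃' a₀ a₁ →
      ∃ ε₀ ε₂₉ γ₀ : ℝ, 0 < ε₀ ∧ 0 < ε₂₉ ∧ 0 < γ₀ ∧ ∃ (b : ℕ → ℝ) (s A c' r : ℝ), OneLoopDrift s A b ∧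
        RunConstRemainder (betaOfRecord₁₃ F 2 (theta13OfThm1CCM F 2 j ε₀ ε₂₉ B₃ B₃' a₀ a₁)) (fun k => c' * b k) r γ₀) :
    ∀ (j c : ℕ) (B₃ B₃' a₀ a₁ : ℝ), c ≤ F.L ^ j → 2 * (F.L : ℝ) ^ 2 ≤ B₃ → 0 < B₃' → 0 < a₀ → 0 < a₁ →
      VariationalThm1RegSepCoP7M F 2 B₃ a₀ a₁ →
      Gauge9RegSepTopStepR F 2 (fun ν K Ω => suppDomOfRecord F ν K Ω) (F.L ^ j) c B₃ B₃' a₀ a₁ →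
      ∃ γ₀ ε₀ ε₂₉ β' : ℝ, 0 < γ₀ ∧ 0 < ε₀ ∧ 0 < ε₂₉ ∧
        RunConstRemainder (betaOfRecord₁₃ F 2 (theta13OfThm1CCM F 2 j ε₀ ε₂₉ B₃ B₃' a₀ a₁)) (fun _ => 0) β' γ₀ := by
  intro j c B₃ B₃' a₀ a₁ hc hB hB' ha₀ ha₁ h15 h9
  obtain ⟨ε₀, ε₂₉, γ₀, hε, hε', hγ₀, b, s, A, c', r, hdrift, hrem⟩ := h j c B₃ B₃' a₀ a₁ hc hB hB' ha₀ ha₁ h15 h9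
  exact ⟨γ₀, ε₀, ε₂₉, |c'| * (|s| + 2 * A) + r, hγ₀, hε, hε', runConstRemainder_zero_of_drift_runConstRemainder hdrift hrem⟩

/-- **★★ (b) ONE-CONSTANT (5.10)-DECAY OF THE LIMITING KERNELS ALONG THE IN-WINDOW RUNS OF A1's WITNESS ⟹ 3ᴿ(F)** (`γ₀ ≤ ½ = θ₁₅ᶜᶜᴹ(j).γ`; β′ := β′₅₁₀(C, δ₁); §2).  The (D4)∕K3
kernel currency (W1-19's `kernelA` of the merged term family of record in the record's β-chart) read at the K0 witness with the constant uniform over runs and levels.  CONDITIONAL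
on the displayed decay (print's (5.10) AT THE RECORD — not inhabited here); nothing asserted. [cite: Balaban1987RG1, (5.10) p.293, (5.42) p.297, (1.22) p.264, Thm 3 p.264; Balaban1985Variational, Thm 1 p.279, Prop. 8 p.304; Balaban1988Convergent, Thm 1 p.262] -/
theorem run3R_of_kernelDecayRunsUniformAt (F : T4Family)
    (h : ∀ (j c : ℕ) (B₃ B₃' a₀ a₁ : ℝ), c ≤ F.L ^ j → 2 * (F.L : ℝ) ^ 2 ≤ B₃ → 0 < B₃' → 0 < a₀ → 0 < a₁ →
      VariationalThm1RegSepCoP7M F 2 B₃ a₀ a₁ →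
      Gauge9RegSepTopStepR F 2 (fun ν K Ω => suppDomOfRecord F ν K Ω) (F.L ^ j) c B₃ B₃' a₀ a₁ →
      ∃ ε₀ ε₂₉ γ₀ C δ₁ : ℝ, 0 < ε₀ ∧ 0 < ε₂₉ ∧ 0 < γ₀ ∧ γ₀ ≤ 1 / 2 ∧ 0 < δ₁ ∧
        (letI := (theta13OfThm1CCM F 2 j ε₀ ε₂₉ B₃ B₃' a₀ a₁).instVβ₁; letI := (theta13OfThm1CCM F 2 j ε₀ ε₂₉ B₃ B₃' a₀ a₁).instVβ₂;
         letI := (theta13OfThm1CCM F 2 j ε₀ ε₂₉ B₃ B₃' a₀ a₁).instιβ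
         ∀ (n : ℕ) (gs : ℕ → ℝ), RGEqH n (betaOfRecord₁₃ F 2 (theta13OfThm1CCM F 2 j ε₀ ε₂₉ B₃ B₃' a₀ a₁)) gs → Step.InInterval γ₀ n gs → ∀ k, k ≤ n →
           Decay510 (kernelA F (mergedTermFamilyMatT F 2 (TβOfRecord₁₃ F 2) (chiβOfRecord₁₃ F 2 (theta13OfThm1CCM F 2 j ε₀ ε₂₉ B₃ B₃' a₀ a₁))
             (theta13OfThm1CCM F 2 j ε₀ ε₂₉ B₃ B₃' a₀ a₁).εbg) (theta13OfThm1CCM F 2 j ε₀ ε₂₉ B₃ B₃' a₀ a₁).ρ8 (theta13OfThm1CCM F 2 j ε₀ ε₂₉ B₃ B₃' a₀ a₁).bV gs k 0 1) C δ₁)) :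
    ∀ (j c : ℕ) (B₃ B₃' a₀ a₁ : ℝ), c ≤ F.L ^ j → 2 * (F.L : ℝ) ^ 2 ≤ B₃ → 0 < B₃' → 0 < a₀ → 0 < a₁ →
      VariationalThm1RegSepCoP7M F 2 B₃ a₀ a₁ →
      Gauge9RegSepTopStepR F 2 (fun ν K Ω => suppDomOfRecord F ν K Ω) (F.L ^ j) c B₃ B₃' a₀ a₁ →
      ∃ γ₀ ε₀ ε₂₉ β' : ℝ, 0 < γ₀ ∧ 0 < ε₀ ∧ 0 < ε₂₉ ∧
        RunConstRemainder (betaOfRecord₁₃ F 2 (theta13OfThm1CCM F 2 j ε₀ ε₂₉ B₃ B₃' a₀ a₁)) (fun _ => 0) β' γ₀ := by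
  intro j c B₃ B₃' a₀ a₁ hc hB hB' ha₀ ha₁ h15 h9
  obtain ⟨ε₀, ε₂₉, γ₀, C, δ₁, hε, hε', hγ₀, hle, hδ, hdec⟩ := h j c B₃ B₃' a₀ a₁ hc hB hB' ha₀ ha₁ h15 h9
  have hle' : γ₀ ≤ (theta13OfThm1CCM F 2 j ε₀ ε₂₉ B₃ B₃' a₀ a₁).γ := by rw [theta13OfThm1CCM_γ]; exact hle
  exact ⟨γ₀, ε₀, ε₂₉, betaPrime510 4 C δ₁, hγ₀, hε, hε', runConstRemainder_zero_of_kernelDecayRunsUniform F 2 _ hδ hle' hdec⟩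

/-- **★★ (b, window edition) ONE-CONSTANT (5.10)-DECAY OF THE LIMITING KERNELS OVER THE WINDOW `]0, γ₀]^ℕ` AT A1's WITNESS ⟹ V19's REGISTERED SOCKET TEXT 3ᴬ′(F) BY NAME**
(`K0V19Defs.AbsBetaBoxAtThm1WitnessCCMGenAt F`; `γ₀ ≤ ½`; β′ := β′₅₁₀(C, δ₁); §3) — the (D4)∕K3 kernel currency feeds the K0 box socket once its constant is uniform over the window.
CONDITIONAL on the displayed decay; stub 3ᴬ′ NOT proved (the hypothesis is not inhabited here); K0⁷ OPEN. [cite: Balaban1987RG1, (5.10) p.293, (5.42) p.297, (1.22) p.264, §1 p.264; Balaban1985Variational, Thm 1 p.279, Prop. 8 p.304; Balaban1988Convergent, Thm 1 p.262] -/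
theorem absBetaBoxGenAt_of_kernelDecayWindowUniformAt (F : T4Family)
    (h : ∀ (j c : ℕ) (B₃ B₃' a₀ a₁ : ℝ), c ≤ F.L ^ j → 2 * (F.L : ℝ) ^ 2 ≤ B₃ → 0 < B₃' → 0 < a₀ → 0 < a₁ →
      VariationalThm1RegSepCoP7M F 2 B₃ a₀ a₁ →
      Gauge9RegSepTopStepR F 2 (fun ν K Ω => suppDomOfRecord F ν K Ω) (F.L ^ j) c B₃ B₃' a₀ a₁ →
      ∃ ε₀ ε₂₉ γ₀ C δ₁ : ℝ, 0 < ε₀ ∧ 0 < ε₂₉ ∧ 0 < γ₀ ∧ γ₀ ≤ 1 / 2 ∧ 0 < δ₁ ∧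
        (letI := (theta13OfThm1CCM F 2 j ε₀ ε₂₉ B₃ B₃' a₀ a₁).instVβ₁; letI := (theta13OfThm1CCM F 2 j ε₀ ε₂₉ B₃ B₃' a₀ a₁).instVβ₂;
         letI := (theta13OfThm1CCM F 2 j ε₀ ε₂₉ B₃ B₃' a₀ a₁).instιβ
         ∀ g ∈ Window γ₀, ∀ k : ℕ,
           Decay510 (kernelA F (mergedTermFamilyMatT F 2 (TβOfRecord₁₃ F 2) (chiβOfRecord₁₃ F 2 (theta13OfThm1CCM F 2 j ε₀ ε₂₉ B₃ B₃' a₀ a₁))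
             (theta13OfThm1CCM F 2 j ε₀ ε₂₉ B₃ B₃' a₀ a₁).εbg) (theta13OfThm1CCM F 2 j ε₀ ε₂₉ B₃ B₃' a₀ a₁).ρ8 (theta13OfThm1CCM F 2 j ε₀ ε₂₉ B₃ B₃' a₀ a₁).bV g k 0 1) C δ₁)) :
    AbsBetaBoxAtThm1WitnessCCMGenAt F := by
  intro j c B₃ B₃' a₀ a₁ hc hB hB' ha₀ ha₁ h15 h9
  obtain ⟨ε₀, ε₂₉, γ₀, C, δ₁, hε, hε', hγ₀, hle, hδ, hdec⟩ := h j c B₃ B₃' a₀ a₁ hc hB hB' ha₀ ha₁ h15 h9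
  have hle' : γ₀ ≤ (theta13OfThm1CCM F 2 j ε₀ ε₂₉ B₃ B₃' a₀ a₁).γ := by rw [theta13OfThm1CCM_γ]; exact hle
  exact ⟨γ₀, ε₀, ε₂₉, betaPrime510 4 C δ₁, hγ₀, hε, hε', absBetaBox_of_kernelDecayWindowUniform F 2 _ hδ hle' hdec⟩

/-- **(b, window ⟹ run) THE WINDOW-UNIFORM DECAY AT A1's WITNESS ALSO GIVES 3ᴿ(F)** (§3 `kernelDecayRunsUniform_of_windowUniform` then (b)) — so the ONE window hypothesis feeds BOTH the
registered box socket 3ᴬ′ and its run-wise face 3ᴿ.  CONDITIONAL. [cite: Balaban1987RG1, (5.10) p.293, (1.22) p.264, Thm 3 p.264 (bookkeeping)] -/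
theorem run3R_of_kernelDecayWindowUniformAt (F : T4Family)
    (h : ∀ (j c : ℕ) (B₃ B₃' a₀ a₁ : ℝ), c ≤ F.L ^ j → 2 * (F.L : ℝ) ^ 2 ≤ B₃ → 0 < B₃' → 0 < a₀ → 0 < a₁ →
      VariationalThm1RegSepCoP7M F 2 B₃ a₀ a₁ →
      Gauge9RegSepTopStepR F 2 (fun ν K Ω => suppDomOfRecord F ν K Ω) (F.L ^ j) c B₃ B₃' a₀ a₁ →
      ∃ ε₀ ε₂₉ γ₀ C δ₁ : ℝ, 0 < ε₀ ∧ 0 < ε₂₉ ∧ 0 < γ₀ ∧ γ₀ ≤ 1 / 2 ∧ 0 < δ₁ ∧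
        (letI := (theta13OfThm1CCM F 2 j ε₀ ε₂₉ B₃ B₃' a₀ a₁).instVβ₁; letI := (theta13OfThm1CCM F 2 j ε₀ ε₂₉ B₃ B₃' a₀ a₁).instVβ₂;
         letI := (theta13OfThm1CCM F 2 j ε₀ ε₂₉ B₃ B₃' a₀ a₁).instιβ
         ∀ g ∈ Window γ₀, ∀ k : ℕ,
           Decay510 (kernelA F (mergedTermFamilyMatT F 2 (TβOfRecord₁₃ F 2) (chiβOfRecord₁₃ F 2 (theta13OfThm1CCM F 2 j ε₀ ε₂₉ B₃ B₃' a₀ a₁))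
             (theta13OfThm1CCM F 2 j ε₀ ε₂₉ B₃ B₃' a₀ a₁).εbg) (theta13OfThm1CCM F 2 j ε₀ ε₂₉ B₃ B₃' a₀ a₁).ρ8 (theta13OfThm1CCM F 2 j ε₀ ε₂₉ B₃ B₃' a₀ a₁).bV g k 0 1) C δ₁)) :
    ∀ (j c : ℕ) (B₃ B₃' a₀ a₁ : ℝ), c ≤ F.L ^ j → 2 * (F.L : ℝ) ^ 2 ≤ B₃ → 0 < B₃' → 0 < a₀ → 0 < a₁ →
      VariationalThm1RegSepCoP7M F 2 B₃ a₀ a₁ →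
      Gauge9RegSepTopStepR F 2 (fun ν K Ω => suppDomOfRecord F ν K Ω) (F.L ^ j) c B₃ B₃' a₀ a₁ →
      ∃ γ₀ ε₀ ε₂₉ β' : ℝ, 0 < γ₀ ∧ 0 < ε₀ ∧ 0 < ε₂₉ ∧
        RunConstRemainder (betaOfRecord₁₃ F 2 (theta13OfThm1CCM F 2 j ε₀ ε₂₉ B₃ B₃' a₀ a₁)) (fun _ => 0) β' γ₀ := by
  refine run3R_of_kernelDecayRunsUniformAt F fun j c B₃ B₃' a₀ a₁ hc hB hB' ha₀ ha₁ h15 h9 => ?_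
  obtain ⟨ε₀, ε₂₉, γ₀, C, δ₁, hε, hε', hγ₀, hle, hδ, hdec⟩ := h j c B₃ B₃' a₀ a₁ hc hB hB' ha₀ ha₁ h15 h9
  exact ⟨ε₀, ε₂₉, γ₀, C, δ₁, hε, hε', hγ₀, hle, hδ, kernelDecayRunsUniform_of_windowUniform F 2 _ hdec⟩

end Witness

/-! ## §5  ★★★ K0⁷ BY NAME from stub 1's text, the landed stub 2′, and the window-uniform (5.10) decay at A1's witness (§4 ∘ `K0V19Stub2Prime`) -/

section ByName

/-- **★★★ K0⁷ BY NAME FROM V19 STUB 1's TEXT, THE LANDED STUB 2′ AND THE WINDOW-UNIFORM (5.10) DECAY OF THE LIMITING KERNELS AT A1's WITNESS** — `h1 : ∀ F, K0V19Defs.Prop8StepCoPAt F`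
(the registered text of `stub_prop8StepCoP13`; NOT proved here); `hdec` = §4's window-uniform decay hypothesis at every family (the (D4)∕K3 kernel currency with ONE constant; print's
(5.10) AT THE RECORD — NOT inhabited here); stub 2′ enters BY NAME inside `K0V19Stub2Prime.record13SepCoPHInhabited_of_stub1_stub3A'_byName` (p595104 ✓).  The crux decl
`Summit.QuantumFields.YangMills.Theses.BalabanUVNodes.Record13SepCoPHInhabited` concluded BY NAME via 3ᴬ′ (`absBetaBoxGenAt_of_kernelDecayWindowUniformAt`).  CONDITIONAL on `h1`
and `hdec`; K0⁷ OPEN; a helper, not a closer; nothing of Bałaban asserted. [cite: Balaban1985Variational, Thm 1 (8)–(9) p.279, Prop. 8 p.304; Balaban1985RegularSpaces, Prop. 6 p.99, p.98; Balaban1988Convergent, Thm 1 p.262, (2.6)–(2.8) pp.255–256; Balaban1987RG1, Thm 1 p.259, (5.10) p.293, (1.22) p.264, §1 p.264] -/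
theorem record13SepCoPHInhabited_of_stub1_of_kernelDecayWindowUniformAt_byName (h1 : ∀ F : T4Family, Prop8StepCoPAt F)
    (hdec : ∀ (F : T4Family) (j c : ℕ) (B₃ B₃' a₀ a₁ : ℝ), c ≤ F.L ^ j → 2 * (F.L : ℝ) ^ 2 ≤ B₃ → 0 < B₃' → 0 < a₀ → 0 < a₁ →
      VariationalThm1RegSepCoP7M F 2 B₃ a₀ a₁ →
      Gauge9RegSepTopStepR F 2 (fun ν K Ω => suppDomOfRecord F ν K Ω) (F.L ^ j) c B₃ B₃' a₀ a₁ →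
      ∃ ε₀ ε₂₉ γ₀ C δ₁ : ℝ, 0 < ε₀ ∧ 0 < ε₂₉ ∧ 0 < γ₀ ∧ γ₀ ≤ 1 / 2 ∧ 0 < δ₁ ∧
        (letI := (theta13OfThm1CCM F 2 j ε₀ ε₂₉ B₃ B₃' a₀ a₁).instVβ₁; letI := (theta13OfThm1CCM F 2 j ε₀ ε₂₉ B₃ B₃' a₀ a₁).instVβ₂;
         letI := (theta13OfThm1CCM F 2 j ε₀ ε₂₉ B₃ B₃' a₀ a₁).instιβ
         ∀ g ∈ Window γ₀, ∀ k : ℕ,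
           Decay510 (kernelA F (mergedTermFamilyMatT F 2 (TβOfRecord₁₃ F 2) (chiβOfRecord₁₃ F 2 (theta13OfThm1CCM F 2 j ε₀ ε₂₉ B₃ B₃' a₀ a₁))
             (theta13OfThm1CCM F 2 j ε₀ ε₂₉ B₃ B₃' a₀ a₁).εbg) (theta13OfThm1CCM F 2 j ε₀ ε₂₉ B₃ B₃' a₀ a₁).ρ8 (theta13OfThm1CCM F 2 j ε₀ ε₂₉ B₃ B₃' a₀ a₁).bV g k 0 1) C δ₁)) :
    Summit.QuantumFields.YangMills.Theses.BalabanUVNodes.Record13SepCoPHInhabited :=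
  record13SepCoPHInhabited_of_stub1_stub3A'_byName h1 fun F => absBetaBoxGenAt_of_kernelDecayWindowUniformAt F (hdec F)

end ByName

end Summit.QuantumFields.YangMills.Theorems.K0Stub3RunwiseSuppliers

end
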